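import Literature.Probability.RandomPlanarGeometry.LoewnerSemigroup
import Mathlib.Analysis.ODE.Gronwall
import HarnessLib

/-!
# One frozen step of the normalized Loewner equation of [LSW] Lemma 3.5

G. F. Lawler, O. Schramm, W. Werner, *Conformal restriction: the chordal case*, J. Amer. Math.
Soc. **16** (2003) 917–955, arXiv:math/0209343 (**[LSW]**), proof of Lemma 3.5, p. 13: the
normalized Loewner equation `∂_t Φ_t(z) = 2Φ_t(z)/((Φ_t(z) - Ũ_t) Ũ_t)` (display (3.5)),
"Since `Ũ_t` is continuous and positive, there is a sequence of piecewise constant functions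
`Ũ^{(n)} : [0, s] → (0, ∞)` such that `sup |Ũ^{(n)}_t - Ũ_t| → 0`. Let `Φ^{(n)}_t` be the solution
of (3.5) with `Ũ^{(n)}_t` replacing `Ũ_t`. Then, clearly, `Φ^{(n)}_s(z) → Φ_s(z)` … Note that the
solution of (3.5) with `Ũ_t` constant is of the form `G^λ_{t'}`, where `λ = Ũ_0` and `t'` is some
function of `t` and `Ũ_0`."

Proof-only infrastructure (no definitions, no named facts) for the forward-stability half of
the density clause of Lemma 3.5 (`IsPlusHull.exists_isLSWGenerated_lswConverges`,
`RestrictionDensity`), on ONE interval of constancy `Ũ^{(n)} ≡ λ` of length `Δ`: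

* `scaled_hasDerivWithinAt_Ici`, `smulHull_lswMap_eq_scaled`, `mem_diff_smul_lswHull_iff` — the
  dilated [LSW] flow `q(τ) = λ G_{τ/λ²}(w/λ) = λ (g(τ/λ²) + 2τ/λ²)` (`g` the chordal Loewner flow
  of the tree driven by `W_t = 1 - 2t`, `LoewnerSemigroup`) is the exact solution of the FROZEN
  equation `q' = 2q/((q - λ)λ)` ("of the form `G^λ_{t'}`", `t' = t/λ²`), ends at the restriction
  map `Φ_{λK_{Δ/λ²}}(w)` of the dilated hull, and is alive iff `w ∉ λK_{Δ/λ²}`;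
* `frozen_step` — **Grönwall comparison with the true flow**: if `u` solves the true equation on
  `[0, Δ]` with `Ũ ≥ c`, `|Ũ - λ| ≤ ω`, `Im u ≥ 2m`, and `dist(w, u(0)) ≤ E` with Grönwall bound
  `gronwallBound E (2/m²) ((2/m² + 2/c²)ω) Δ < m`, then `w ∉ λK_{Δ/λ²}` and
  `dist(Φ_{λK_{Δ/λ²}}(w), u(Δ))` is at most that bound (the true field is `2/m²`-Lipschitz on
  `{Im ≥ m}`, `lipschitzOnWith_normalizedField`, freezing costs `(2/m² + 2/c²)ω`,
  `dist_normalizedField_le`; Mathlib's `dist_le_of_approx_trajectories_ODE_of_mem`, a first-exit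
  argument, and the extension criterion `lt_swallowingTime_of_le_norm_sub`: a dying solution
  approaches the real point `λ`);
* `small_step`, `large_step` — the dilated flow from `|w| ≤ (c/4)e^{-4Δ/c²}` stays small and
  alive, from `|w| > 2C + 4Δ/c` stays large and alive (the approximating hulls stay in a fixed
  annulus).

Iterating these over a partition of `[0, s]` (file `NormalizedLoewnerStability`) gives
`Φ^{(n)}_s → Φ_s` on compacts of `ℍ ∖ J` with hulls in `𝒜₀` in a fixed annulus, i.e. the
`LSWConverges` approximation of a smooth hull by `𝒜₀`.
-/

noncomputable section

open Set Filter Metric Complex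
open _root_.Topology
open UpperHalfPlane (upperHalfPlaneSet isOpen_upperHalfPlaneSet)
open scoped NNReal Pointwise

namespace Literature.Probability.RandomPlanarGeometry

open Loewner

/-! ### The dilated flow `q(τ) = λ G_{τ/λ²}(w/λ)` solves the frozen equation `q' = 2q/((q - λ)λ)` -/

section Scaled

variable {lam : ℝ} {w : ℂ} {g : ℝ → ℂ} {T : WithTop ℝ≥0}

/-- The time domain of a solution contains `[0, b]` as soon as it contains `b`. [folklore] -/
theorem toNNReal_div_sq_lt_of_le (hlam : 0 < lam) {τ b : ℝ} (hτ : τ ≤ b)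
    (hb : ((b / lam ^ 2).toNNReal : WithTop ℝ≥0) < T) :
    ((τ / lam ^ 2).toNNReal : WithTop ℝ≥0) < T :=
  lt_of_le_of_lt (WithTop.coe_le_coe.2 (Real.toNNReal_le_toNNReal
    (div_le_div_of_nonneg_right hτ (by positivity)))) hb

/-- `q(τ) - λ = λ (g(τ/λ²) - W_{τ/λ²})` for the dilated path `q(τ) = λ (g(τ/λ²) + 2τ/λ²)` of a
solution `g` of the Loewner equation driven by `W_t = 1 - 2t` (`τ ≥ 0`). [folklore] -/
theorem scaled_sub_eq (hlam : 0 < lam) {τ : ℝ} (hτ : 0 ≤ τ) :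
    (lam : ℂ) * (g (τ / lam ^ 2) + 2 * ((τ / lam ^ 2 : ℝ) : ℂ)) - lam =
      lam * (g (τ / lam ^ 2) - lswDriving (τ / lam ^ 2).toNNReal) := by
  rw [lswDriving_apply, Real.coe_toNNReal _ (by positivity)]
  push_cast
  ring

/-- **The dilated flow solves the frozen normalized equation**: if `g` solves the Loewner
equation driven by `W_t = 1 - 2t`, then `q(τ) = λ (g(τ/λ²) + 2τ/λ²)` has right derivative
`2q/((q - λ)λ)` at every `τ ∈ [0, b)` with `b/λ² < T` ([LSW] p. 13: "the solution of (3.5) with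
`Ũ_t` constant is of the form `G^λ_{t'}`, where `λ = Ũ_0` and `t'` is some function of `t` and
`Ũ_0`" — namely `t' = t/λ²`). [cite: LawlerSchrammWerner2003Restriction, proof of Lemma 3.5 (p. 13), "G^λ_{t'}"] -/
theorem scaled_hasDerivWithinAt_Ici (hlam : 0 < lam) (hg : IsSolution lswDriving (lam⁻¹ • w) g T)
    {b : ℝ} (hb : ((b / lam ^ 2).toNNReal : WithTop ℝ≥0) < T) {τ : ℝ} (hτ : τ ∈ Ico 0 b) :
    HasDerivWithinAt (fun τ : ℝ ↦ (lam : ℂ) * (g (τ / lam ^ 2) + 2 * ((τ / lam ^ 2 : ℝ) : ℂ)))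
      (2 * ((lam : ℂ) * (g (τ / lam ^ 2) + 2 * ((τ / lam ^ 2 : ℝ) : ℂ))) /
        (((lam : ℂ) * (g (τ / lam ^ 2) + 2 * ((τ / lam ^ 2 : ℝ) : ℂ)) - lam) * lam))
      (Ici τ) τ := by
  have hl2 : (0 : ℝ) < lam ^ 2 := by positivity
  have hsub : Icc 0 (b / lam ^ 2) ⊆ {t : ℝ | 0 ≤ t ∧ (t.toNNReal : WithTop ℝ≥0) < T} :=
    Icc_subset_timeDomain hb
  have hτ' : τ / lam ^ 2 ∈ Ico 0 (b / lam ^ 2) :=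
    ⟨div_nonneg hτ.1 hl2.le, div_lt_div_of_pos_right hτ.2 hl2⟩
  -- the inner solution
  have h1 : HasDerivWithinAt g (vectorField lswDriving (τ / lam ^ 2) (g (τ / lam ^ 2)))
      (Ici (τ / lam ^ 2)) (τ / lam ^ 2) := hg.hasDerivWithinAt_Ici hsub _ hτ'
  have h2 : HasDerivWithinAt (fun σ : ℝ ↦ σ / lam ^ 2) (1 / lam ^ 2) (Ici τ) τ := by
    simpa [div_eq_mul_inv] using ((hasDerivAt_id τ).mul_const (lam ^ 2)⁻¹).hasDerivWithinAt
  have h3 : HasDerivWithinAt (fun σ : ℝ ↦ g (σ / lam ^ 2))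
      ((1 / lam ^ 2 : ℝ) • vectorField lswDriving (τ / lam ^ 2) (g (τ / lam ^ 2))) (Ici τ) τ :=
    h1.scomp τ h2 fun σ hσ ↦ (div_le_div_of_nonneg_right (show τ ≤ σ from hσ) hl2.le)
  have h4 : HasDerivWithinAt (fun σ : ℝ ↦ (2 : ℂ) * ((σ / lam ^ 2 : ℝ) : ℂ)) (2 * (((1 / lam ^ 2 : ℝ)) : ℂ))
      (Ici τ) τ := by
    have := (h2.ofReal_comp).const_mul (2 : ℂ)
    simpa using this
  have h5 := ((h3.add h4).const_mul (lam : ℂ))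
  -- identify the derivative
  have hval : vectorField lswDriving (τ / lam ^ 2) (g (τ / lam ^ 2)) =
      2 / (g (τ / lam ^ 2) - (1 - 2 * ((τ / lam ^ 2 : ℝ) : ℂ))) := by
    rw [vectorField_apply, lswDriving_apply, Real.coe_toNNReal _ hτ'.1]
    push_cast
    ring
  have hne : g (τ / lam ^ 2) - (1 - 2 * ((τ / lam ^ 2 : ℝ) : ℂ)) ≠ 0 := by
    have := hg.ne hτ'.1 (hsub ⟨hτ'.1, hτ'.2.le⟩).2
    rw [lswDriving_apply, Real.coe_toNNReal _ hτ'.1] at this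
    intro h0
    apply this
    have : g (τ / lam ^ 2) = 1 - 2 * ((τ / lam ^ 2 : ℝ) : ℂ) := sub_eq_zero.1 h0
    rw [this]
    push_cast
    ring
  have hlamC : (lam : ℂ) ≠ 0 := by exact_mod_cast hlam.ne'
  refine h5.congr_deriv ?_
  rw [hval, Complex.real_smul]
  set G := g (τ / lam ^ 2) with hG
  set c : ℂ := ((τ / lam ^ 2 : ℝ) : ℂ) with hc
  have hden : (lam : ℂ) * (G + 2 * c) - lam = lam * (G - (1 - 2 * c)) := by ring
  rw [hden]
  push_cast
  field_simp
  ring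

/-- The dilated path is continuous on `[0, b]` when `b/λ² < T`. [folklore] -/
theorem scaled_continuousOn (hlam : 0 < lam) (hg : IsSolution lswDriving (lam⁻¹ • w) g T)
    {b : ℝ} (hb : ((b / lam ^ 2).toNNReal : WithTop ℝ≥0) < T) :
    ContinuousOn (fun τ : ℝ ↦ (lam : ℂ) * (g (τ / lam ^ 2) + 2 * ((τ / lam ^ 2 : ℝ) : ℂ)))
      (Icc 0 b) := by
  have hl2 : (0 : ℝ) < lam ^ 2 := by positivity
  have hsub : Icc 0 (b / lam ^ 2) ⊆ {t : ℝ | 0 ≤ t ∧ (t.toNNReal : WithTop ℝ≥0) < T} :=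
    Icc_subset_timeDomain hb
  have hmaps : MapsTo (fun τ : ℝ ↦ τ / lam ^ 2) (Icc 0 b) (Icc 0 (b / lam ^ 2)) := fun τ hτ ↦
    ⟨div_nonneg hτ.1 hl2.le, div_le_div_of_nonneg_right hτ.2 hl2.le⟩
  have h1 : ContinuousOn (fun τ : ℝ ↦ g (τ / lam ^ 2)) (Icc 0 b) :=
    (hg.continuousOn.mono hsub).comp (continuous_id.div_const _).continuousOn hmaps
  refine continuousOn_const.mul (h1.add ?_)
  exact (continuous_const.mul (Complex.continuous_ofReal.comp (continuous_id.div_const _))).continuousOn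

/-- The dilated path starts at `w`. [folklore] -/
theorem scaled_apply_zero (hlam : 0 < lam) (hg : IsSolution lswDriving (lam⁻¹ • w) g T) :
    (lam : ℂ) * (g (0 / lam ^ 2) + 2 * ((0 / lam ^ 2 : ℝ) : ℂ)) = w := by
  rw [zero_div, hg.apply_zero, Complex.real_smul]
  have hlamC : (lam : ℂ) ≠ 0 := by exact_mod_cast hlam.ne'
  push_cast
  field_simp
  ring

/-- **The dilated path ends at `Φ_{λK_{Δ/λ²}}(w) = λ G_{Δ/λ²}(w/λ)`** when `w/λ` is still flowing
at time `Δ/λ²`. [cite: LawlerSchrammWerner2003Restriction, Prop. 3.3 proof (p. 11), "G_t^λ(z) = λG_t(λ⁻¹z)"] -/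
theorem smulHull_lswMap_eq_scaled (hlam : 0 < lam) (hg : IsSolution lswDriving (lam⁻¹ • w) g T)
    {Δ : ℝ} (hΔ : 0 ≤ Δ) (hT : T = swallowingTime lswDriving (lam⁻¹ • w))
    (halive : (((Δ / lam ^ 2).toNNReal : ℝ≥0) : WithTop ℝ≥0) < swallowingTime lswDriving (lam⁻¹ • w)) :
    (lswMap (Δ / lam ^ 2).toNNReal).smulHull lam hlam w =
      (lam : ℂ) * (g (Δ / lam ^ 2) + 2 * ((Δ / lam ^ 2 : ℝ) : ℂ)) := by
  subst hT
  rw [ConformalEquiv.smulHull_apply, lswMap_apply, map_eq_of_isSolution continuous_lswDriving hg halive,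
    Real.coe_toNNReal _ (by positivity), Complex.real_smul]

/-- **Aliveness**: `w ∈ ℍ ∖ λK_t ↔ w/λ ∈ ℍ` and `t < T_{w/λ}`. [folklore] -/
theorem mem_diff_smul_lswHull_iff (hlam : 0 < lam) (t : ℝ≥0) :
    w ∈ upperHalfPlaneSet \ lam • lswHull t ↔
      lam⁻¹ • w ∈ upperHalfPlaneSet ∧ (t : WithTop ℝ≥0) < swallowingTime lswDriving (lam⁻¹ • w) := by
  rw [mem_diff_smul_iff hlam, diff_lswHull, mem_domain_iff]

/-- `w/λ ∈ ℍ ↔ w ∈ ℍ` (`λ > 0`). [folklore] -/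
theorem inv_smul_mem_upperHalfPlaneSet_iff (hlam : 0 < lam) :
    lam⁻¹ • w ∈ upperHalfPlaneSet ↔ w ∈ upperHalfPlaneSet := by
  show 0 < (lam⁻¹ • w).im ↔ 0 < w.im
  rw [Complex.smul_im, smul_eq_mul]
  exact mul_pos_iff_of_pos_left (inv_pos.2 hlam)

end Scaled

/-! ### The normalized field: Lipschitz bound and frozen-coefficient error -/

section Field

/-- `2x/((x - a)a) = 2/a + 2/(x - a)` off the singularities. [folklore] -/
theorem normalizedField_eq {x : ℂ} {a : ℝ} (ha : a ≠ 0) (hx : x ≠ a) :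
    2 * x / ((x - a) * a) = 2 / a + 2 / (x - a) := by
  have h1 : (x - a) ≠ 0 := sub_ne_zero.2 hx
  have h2 : (a : ℂ) ≠ 0 := by exact_mod_cast ha
  field_simp
  ring

/-- A point with `Im x ≥ m > 0` is `m`-far from every real `a`. [folklore] -/
theorem le_norm_sub_ofReal_of_le_im {x : ℂ} {m : ℝ} (hx : m ≤ x.im) (a : ℝ) : m ≤ ‖x - a‖ := by
  have := abs_im_le_norm (x - a)
  rw [sub_im, ofReal_im, sub_zero] at this
  exact hx.trans ((le_abs_self _).trans this)

/-- **The normalized field `x ↦ 2x/((x - a)a)` is `2/m²`-Lipschitz on `{Im ≥ m}`** (`a` real,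
nonzero). [folklore] -/
theorem lipschitzOnWith_normalizedField {a m : ℝ} (ha : a ≠ 0) (hm : 0 < m) :
    LipschitzOnWith (Real.toNNReal (2 / m ^ 2)) (fun x : ℂ ↦ 2 * x / ((x - a) * a))
      {x : ℂ | m ≤ x.im} := by
  refine LipschitzOnWith.of_dist_le_mul fun x hx y hy ↦ ?_
  have hxm : m ≤ ‖x - a‖ := le_norm_sub_ofReal_of_le_im hx a
  have hym : m ≤ ‖y - a‖ := le_norm_sub_ofReal_of_le_im hy a
  have hxa : x ≠ a := fun h ↦ by rw [h] at hxm; simp at hxm; linarith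
  have hya : y ≠ a := fun h ↦ by rw [h] at hym; simp at hym; linarith
  rw [normalizedField_eq ha hxa, normalizedField_eq ha hya, dist_add_left, dist_eq_norm,
    Real.coe_toNNReal _ (by positivity)]
  have hx0 : x - a ≠ 0 := sub_ne_zero.2 hxa
  have hy0 : y - a ≠ 0 := sub_ne_zero.2 hya
  have heq : (2 : ℂ) / (x - a) - 2 / (y - a) = 2 * (y - x) / ((x - a) * (y - a)) := by
    field_simp; ring
  rw [heq, norm_div, norm_mul, norm_mul, Complex.norm_two, dist_eq_norm]
  rw [div_le_iff₀ (by positivity)]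
  have h1 : ‖y - x‖ = ‖x - y‖ := norm_sub_rev _ _
  rw [h1]
  have hmm : m * m ≤ ‖x - (a : ℂ)‖ * ‖y - a‖ := mul_le_mul hxm hym hm.le (norm_nonneg _)
  have : 2 * ‖x - y‖ * (m * m) ≤ 2 * ‖x - y‖ * (‖x - (a : ℂ)‖ * ‖y - a‖) :=
    mul_le_mul_of_nonneg_left hmm (by positivity)
  calc 2 * ‖x - y‖ = 2 / m ^ 2 * ‖x - y‖ * (m * m) := by field_simp
    _ ≤ 2 / m ^ 2 * ‖x - y‖ * (‖x - (a : ℂ)‖ * ‖y - a‖) := by gcongr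

/-- **Freezing the coefficient costs `(2/m² + 2/c²) ω`**: for `Im x ≥ m`, reals `a, b ≥ c > 0`
with `|a - b| ≤ ω`, `|2x/((x - a)a) - 2x/((x - b)b)| ≤ (2/m² + 2/c²) ω`. [folklore] -/
theorem dist_normalizedField_le {x : ℂ} {a b c m ω : ℝ} (hc : 0 < c) (hm : 0 < m)
    (ha : c ≤ a) (hb : c ≤ b) (hab : |a - b| ≤ ω) (hx : m ≤ x.im) :
    dist (2 * x / ((x - a) * a)) (2 * x / ((x - b) * b)) ≤ (2 / m ^ 2 + 2 / c ^ 2) * ω := by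
  have ha0 : a ≠ 0 := (hc.trans_le ha).ne'
  have hb0 : b ≠ 0 := (hc.trans_le hb).ne'
  have hxm : m ≤ ‖x - a‖ := le_norm_sub_ofReal_of_le_im hx a
  have hxm' : m ≤ ‖x - b‖ := le_norm_sub_ofReal_of_le_im hx b
  have hxa : x ≠ a := fun h ↦ by rw [h] at hxm; simp at hxm; linarith
  have hxb : x ≠ b := fun h ↦ by rw [h] at hxm'; simp at hxm'; linarith
  have hω : 0 ≤ ω := (abs_nonneg _).trans hab
  rw [normalizedField_eq ha0 hxa, normalizedField_eq hb0 hxb, dist_eq_norm]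
  have hxa0 : x - a ≠ 0 := sub_ne_zero.2 hxa
  have hxb0 : x - b ≠ 0 := sub_ne_zero.2 hxb
  have haC : (a : ℂ) ≠ 0 := by exact_mod_cast ha0
  have hbC : (b : ℂ) ≠ 0 := by exact_mod_cast hb0
  have heq : (2 : ℂ) / a + 2 / (x - a) - (2 / b + 2 / (x - b)) =
      2 * ((b : ℂ) - a) / (a * b) + 2 * ((a : ℂ) - b) / ((x - a) * (x - b)) := by
    field_simp; ring
  rw [heq]
  have hab' : ‖(a : ℂ) - b‖ ≤ ω := by
    rw [← Complex.ofReal_sub, Complex.norm_real, Real.norm_eq_abs]; exact hab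
  have hba' : ‖(b : ℂ) - a‖ ≤ ω := by rw [norm_sub_rev]; exact hab'
  have h1 : ‖2 * ((b : ℂ) - a) / (a * b)‖ ≤ 2 / c ^ 2 * ω := by
    rw [norm_div, norm_mul, norm_mul, Complex.norm_two, Complex.norm_real, Complex.norm_real,
      Real.norm_eq_abs, Real.norm_eq_abs, abs_of_pos (hc.trans_le ha), abs_of_pos (hc.trans_le hb),
      div_le_iff₀ (mul_pos (hc.trans_le ha) (hc.trans_le hb))]
    have : c ^ 2 ≤ a * b := by nlinarith
    calc 2 * ‖(b : ℂ) - a‖ ≤ 2 * ω := by linarith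
      _ = 2 / c ^ 2 * ω * c ^ 2 := by field_simp
      _ ≤ 2 / c ^ 2 * ω * (a * b) := by gcongr
  have h2 : ‖2 * ((a : ℂ) - b) / ((x - a) * (x - b))‖ ≤ 2 / m ^ 2 * ω := by
    rw [norm_div, norm_mul, norm_mul, Complex.norm_two, div_le_iff₀ (by positivity)]
    have : m * m ≤ ‖x - (a : ℂ)‖ * ‖x - b‖ := mul_le_mul hxm hxm' hm.le (norm_nonneg _)
    calc 2 * ‖(a : ℂ) - b‖ ≤ 2 * ω := by linarith
      _ = 2 / m ^ 2 * ω * (m * m) := by field_simp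
      _ ≤ 2 / m ^ 2 * ω * (‖x - (a : ℂ)‖ * ‖x - b‖) := by gcongr
  calc ‖2 * ((b : ℂ) - a) / (a * b) + 2 * ((a : ℂ) - b) / ((x - a) * (x - b))‖
      ≤ ‖2 * ((b : ℂ) - a) / (a * b)‖ + ‖2 * ((a : ℂ) - b) / ((x - a) * (x - b))‖ := norm_add_le _ _
    _ ≤ 2 / c ^ 2 * ω + 2 / m ^ 2 * ω := add_le_add h1 h2
    _ = (2 / m ^ 2 + 2 / c ^ 2) * ω := by ring

/-- The Grönwall bound is nonnegative for nonnegative data. [folklore] -/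
theorem gronwallBound_nonneg {δ K ε x : ℝ} (hδ : 0 ≤ δ) (hK : 0 ≤ K) (hε : 0 ≤ ε) (hx : 0 ≤ x) :
    0 ≤ gronwallBound δ K ε x := by
  rcases eq_or_ne K 0 with rfl | hK0
  · rw [gronwallBound_K0]; positivity
  · rw [gronwallBound_of_K_ne_0 hK0]
    have hK' : 0 < K := lt_of_le_of_ne hK hK0.symm
    have h1 : 1 ≤ Real.exp (K * x) := Real.one_le_exp (by positivity)
    have : 0 ≤ ε / K * (Real.exp (K * x) - 1) := mul_nonneg (div_nonneg hε hK) (by linarith)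
    have h2 : 0 ≤ δ * Real.exp (K * x) := by positivity
    linarith

/-- The Grönwall bound increases with time for nonnegative data. [folklore] -/
theorem gronwallBound_mono {δ K ε : ℝ} (hδ : 0 ≤ δ) (hK : 0 ≤ K) (hε : 0 ≤ ε) {x y : ℝ}
    (hx : 0 ≤ x) (hxy : x ≤ y) : gronwallBound δ K ε x ≤ gronwallBound δ K ε y := by
  have hmono : MonotoneOn (gronwallBound δ K ε) (Ici 0) := by
    refine monotoneOn_of_deriv_nonneg (convex_Ici 0)
      (fun z _ ↦ (hasDerivAt_gronwallBound δ K ε z).continuousAt.continuousWithinAt)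
      (fun z _ ↦ (hasDerivAt_gronwallBound δ K ε z).differentiableAt.differentiableWithinAt)
      fun z hz ↦ ?_
    rw [interior_Ici] at hz
    rw [(hasDerivAt_gronwallBound δ K ε z).deriv]
    have := gronwallBound_nonneg hδ hK hε (le_of_lt hz)
    positivity
  exact hmono hx (hx.trans hxy) hxy

end Field

/-! ### One frozen step: Grönwall comparison with the true flow, and aliveness -/

section Step

/-- **One frozen step of the normalized Loewner equation** ([LSW] p. 13: "Let `Φ^{(n)}_t` be the
solution of (3.5) with `Ũ^{(n)}_t` replacing `Ũ_t`. Then, clearly, `Φ^{(n)}_s(z) → Φ_s(z)`" — the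
elementary stability behind "clearly", for one interval of constancy `Ũ^{(n)} ≡ λ`). Let `u`
solve the true equation `u' = 2u/((u - Ũ_t) Ũ_t)` on `[0, Δ]` with `Ũ_t ≥ c > 0`,
`|Ũ_t - λ| ≤ ω`, `λ ≥ c`, and `Im u ≥ 2m`; let `dist(w, u(0)) ≤ E` with Grönwall bound
`B = gronwallBound E (2/m²) ((2/m² + 2/c²) ω) Δ < m`. Then the dilated [LSW] flow from `w`
(the exact solution of the frozen equation `q' = 2q/((q - λ)λ)`, `scaled_hasDerivWithinAt_Ici`)
is alive at time `Δ`, i.e. `w ∈ ℍ ∖ λK_{Δ/λ²}`, and `dist(λG_{Δ/λ²}(w/λ), u(Δ)) ≤ B`: as long as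
`q` is `m`-close to `u` it stays in `{Im ≥ m}` where the true field is `2/m²`-Lipschitz and the
frozen field is within `(2/m² + 2/c²) ω` of it (Grönwall, first exit), and a dying solution would
approach the real singularity `λ`. [cite: LawlerSchrammWerner2003Restriction, proof of Lemma 3.5 (p. 13), "Φ^{(n)}_s(z) → Φ_s(z)"] -/
theorem frozen_step {U : ℝ → ℝ} {u : ℝ → ℂ} {Δ lam c m ω E : ℝ} {w : ℂ}
    (hΔ : 0 ≤ Δ) (hc : 0 < c) (hm : 0 < m) (hlam : c ≤ lam) (hω : 0 ≤ ω) (hE0 : 0 ≤ E)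
    (hU : ∀ t ∈ Icc 0 Δ, c ≤ U t) (hUlam : ∀ t ∈ Icc 0 Δ, |lam - U t| ≤ ω)
    (hu : ContinuousOn u (Icc 0 Δ))
    (hu' : ∀ t ∈ Ico 0 Δ, HasDerivWithinAt u (2 * u t / ((u t - U t) * U t)) (Ici t) t)
    (huim : ∀ t ∈ Icc 0 Δ, 2 * m ≤ (u t).im) (hw : dist w (u 0) ≤ E)
    (hB : gronwallBound E (2 / m ^ 2) ((2 / m ^ 2 + 2 / c ^ 2) * ω) Δ < m) :
    w ∈ upperHalfPlaneSet \ lam • lswHull (Δ / lam ^ 2).toNNReal ∧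
      dist ((lswMap (Δ / lam ^ 2).toNNReal).smulHull lam (hc.trans_le hlam) w) (u Δ) ≤
        gronwallBound E (2 / m ^ 2) ((2 / m ^ 2 + 2 / c ^ 2) * ω) Δ := by
  have hlam0 : 0 < lam := hc.trans_le hlam
  have hl2 : (0 : ℝ) < lam ^ 2 := by positivity
  set η : ℝ := (2 / m ^ 2 + 2 / c ^ 2) * ω with hη
  have hη0 : 0 ≤ η := by positivity
  set Kr : ℝ := 2 / m ^ 2 with hKr
  have hKr0 : 0 ≤ Kr := by positivity
  set gB : ℝ → ℝ := gronwallBound E Kr η with hgB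
  have hgBmono : ∀ {x y : ℝ}, 0 ≤ x → x ≤ y → gB x ≤ gB y := fun hx hxy ↦
    gronwallBound_mono hE0 hKr0 hη0 hx hxy
  have hEm : E < m := by
    have : gB 0 ≤ gB Δ := hgBmono le_rfl hΔ
    rw [hgB, gronwallBound_x0] at this
    exact this.trans_lt hB
  -- `w` is in the half-plane, above height `m`
  have hwim : m < w.im := by
    have h1 := abs_im_le_norm (w - u 0)
    rw [sub_im] at h1
    rw [dist_eq_norm] at hw
    have h2 := huim 0 ⟨le_rfl, hΔ⟩
    have := (abs_le.1 (h1.trans hw)).1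
    linarith
  have hwH : w ∈ upperHalfPlaneSet := show 0 < w.im from hm.trans hwim
  have hw'H : lam⁻¹ • w ∈ upperHalfPlaneSet := (inv_smul_mem_upperHalfPlaneSet_iff hlam0).2 hwH
  have hw'1 : lam⁻¹ • w ≠ lswDriving 0 := fun h ↦ by
    have : (lam⁻¹ • w).im = 0 := by rw [h]; simp
    exact absurd this (ne_of_gt hw'H)
  obtain ⟨g, hg⟩ := exists_isSolution_swallowingTime_holds continuous_lswDriving hw'1
  set T := swallowingTime lswDriving (lam⁻¹ • w) with hT
  set q : ℝ → ℂ := fun τ ↦ (lam : ℂ) * (g (τ / lam ^ 2) + 2 * ((τ / lam ^ 2 : ℝ) : ℂ)) with hq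
  have hq0 : q 0 = w := scaled_apply_zero hlam0 hg
  -- the true field and its Lipschitz bound
  set v : ℝ → ℂ → ℂ := fun t x ↦ 2 * x / ((x - U t) * U t) with hv
  have hvLip : ∀ t ∈ Icc 0 Δ, LipschitzOnWith (Real.toNNReal Kr) (v t) {x : ℂ | m ≤ x.im} :=
    fun t ht ↦ lipschitzOnWith_normalizedField (hc.trans_le (hU t ht)).ne' hm
  -- Grönwall on `[0, b]`, given `m`-closeness on `[0, b)`
  have gron : ∀ b : ℝ, 0 ≤ b → b ≤ Δ → ((b / lam ^ 2).toNNReal : WithTop ℝ≥0) < T →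
      (∀ τ ∈ Ico 0 b, dist (q τ) (u τ) < m) → ∀ τ ∈ Icc 0 b, dist (q τ) (u τ) ≤ gB τ := by
    intro b hb0 hbΔ hbT hclose τ hτ
    have key := dist_le_of_approx_trajectories_ODE_of_mem (v := v)
      (s := fun _ ↦ {x : ℂ | m ≤ x.im}) (K := Real.toNNReal Kr) (δ := E) (εf := η) (εg := 0)
      (f := q) (g := u) (a := 0) (b := b)
      (f' := fun τ ↦ 2 * q τ / ((q τ - lam) * lam)) (g' := fun τ ↦ v τ (u τ))
      (fun t ht ↦ hvLip t ⟨ht.1, ht.2.le.trans hbΔ⟩)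
      (scaled_continuousOn hlam0 hg hbT)
      (fun t ht ↦ scaled_hasDerivWithinAt_Ici hlam0 hg hbT ht)
      (fun t ht ↦ by
        have htΔ : t ∈ Icc 0 Δ := ⟨ht.1, ht.2.le.trans hbΔ⟩
        have hqim : m ≤ (q t).im := by
          have h1 := abs_im_le_norm (q t - u t)
          rw [sub_im] at h1
          have h2 := hclose t ht
          rw [dist_eq_norm] at h2
          have := (abs_le.1 (h1.trans h2.le)).1
          linarith [huim t htΔ]
        exact dist_normalizedField_le hc hm hlam (hU t htΔ) (hUlam t htΔ) hqim)
      (fun t ht ↦ by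
        have h1 := abs_im_le_norm (q t - u t)
        rw [sub_im] at h1
        have h2 := hclose t ht
        rw [dist_eq_norm] at h2
        have := (abs_le.1 (h1.trans h2.le)).1
        show m ≤ (q t).im
        linarith [huim t ⟨ht.1, ht.2.le.trans hbΔ⟩])
      (hu.mono (Icc_subset_Icc le_rfl hbΔ))
      (fun t ht ↦ hu' t ⟨ht.1, ht.2.trans_le hbΔ⟩)
      (fun t _ ↦ by simp)
      (fun t ht ↦ show m ≤ (u t).im by linarith [huim t ⟨ht.1, ht.2.le.trans hbΔ⟩])
      (by rw [hq0]; exact hw)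
    have := key τ hτ
    rwa [add_zero, sub_zero, Real.coe_toNNReal _ hKr0] at this
  -- first exit: `m`-closeness on every alive `[0, b]`, hence the Grönwall bound there
  have claimA : ∀ b : ℝ, 0 ≤ b → b ≤ Δ → ((b / lam ^ 2).toNNReal : WithTop ℝ≥0) < T →
      ∀ τ ∈ Icc 0 b, dist (q τ) (u τ) ≤ gB τ := by
    intro b hb0 hbΔ hbT
    refine gron b hb0 hbΔ hbT fun s₁ hs₁ ↦ ?_
    by_contra hnot
    rw [not_lt] at hnot
    have hcont : ContinuousOn (fun τ ↦ dist (q τ) (u τ)) (Icc 0 b) :=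
      continuous_dist.comp_continuousOn ((scaled_continuousOn hlam0 hg hbT).prodMk
        (hu.mono (Icc_subset_Icc le_rfl hbΔ)))
    set S : Set ℝ := Icc 0 b ∩ (fun τ ↦ dist (q τ) (u τ)) ⁻¹' Ici m with hS
    have hSc : IsClosed S := hcont.preimage_isClosed_of_isClosed isClosed_Icc isClosed_Ici
    have hs₁S : s₁ ∈ S := ⟨⟨hs₁.1, hs₁.2.le⟩, hnot⟩
    have hSbdd : BddBelow S := ⟨0, fun τ hτ ↦ hτ.1.1⟩
    set s₀ := sInf S with hs₀
    have hs₀S : s₀ ∈ S := hSc.csInf_mem ⟨s₁, hs₁S⟩ hSbdd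
    have hs₀0 : 0 ≤ s₀ := hs₀S.1.1
    have hs₀b : s₀ ≤ b := hs₀S.1.2
    have hbefore : ∀ τ ∈ Ico 0 s₀, dist (q τ) (u τ) < m := fun τ hτ ↦ by
      by_contra hge
      rw [not_lt] at hge
      have hτS : τ ∈ S := ⟨⟨hτ.1, hτ.2.le.trans hs₀b⟩, hge⟩
      exact absurd (csInf_le hSbdd hτS) (not_le.2 hτ.2)
    have h1 := gron s₀ hs₀0 (hs₀b.trans hbΔ) (toNNReal_div_sq_lt_of_le hlam0 hs₀b hbT)
      hbefore s₀ ⟨hs₀0, le_rfl⟩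
    have h2 : gB s₀ < m := (hgBmono hs₀0 (hs₀b.trans hbΔ)).trans_lt hB
    have h3 : m ≤ dist (q s₀) (u s₀) := hs₀S.2
    linarith
  -- aliveness at time `Δ/λ²`
  have claimB : (((Δ / lam ^ 2).toNNReal : ℝ≥0) : WithTop ℝ≥0) < T := by
    by_contra hcon
    rw [not_lt] at hcon
    have hTtop : T ≠ ⊤ := ne_top_of_le_ne_top WithTop.coe_ne_top hcon
    obtain ⟨b₀, hb₀⟩ := WithTop.ne_top_iff_exists.1 hTtop
    have hb₀le : (b₀ : ℝ) ≤ Δ / lam ^ 2 := by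
      have := WithTop.coe_le_coe.1 (hb₀.symm ▸ hcon : (b₀ : WithTop ℝ≥0) ≤ (Δ / lam ^ 2).toNNReal)
      have h := NNReal.coe_le_coe.2 this
      rwa [Real.coe_toNNReal _ (by positivity)] at h
    have hb₀pos : 0 < b₀ := by
      have := swallowingTime_pos_holds continuous_lswDriving hw'1
      rw [← hT, ← hb₀] at this
      exact WithTop.coe_pos.1 this
    have hg' : IsSolution lswDriving (lam⁻¹ • w) g b₀ := by rw [hb₀]; exact hg
    obtain ⟨t, ht0, htb, hlt⟩ := hg'.exists_norm_sub_lt continuous_lswDriving hb₀pos hb₀.symm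
      (δ := m / lam) (by positivity)
    -- at `τ = λ² t` the dilated path is `m`-close to `u`, hence above height `m`, yet `|q - λ| < m`
    set τ : ℝ := lam ^ 2 * t with hτdef
    have hτt : τ / lam ^ 2 = t := by rw [hτdef]; field_simp
    have hτ0 : 0 ≤ τ := by positivity
    have hτΔ : τ ≤ Δ := by
      have : lam ^ 2 * t ≤ lam ^ 2 * (Δ / lam ^ 2) :=
        mul_le_mul_of_nonneg_left (htb.le.trans hb₀le) hl2.le
      rwa [mul_div_cancel₀ _ hl2.ne'] at this
    have hτT : ((τ / lam ^ 2).toNNReal : WithTop ℝ≥0) < T := by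
      rw [hτt, ← hb₀]
      exact WithTop.coe_lt_coe.2 (by
        rw [← NNReal.coe_lt_coe, Real.coe_toNNReal _ ht0]; exact htb)
    have hA := claimA τ hτ0 hτΔ hτT τ ⟨hτ0, le_rfl⟩
    have hqim : m < (q τ).im := by
      have h1 := abs_im_le_norm (q τ - u τ)
      rw [sub_im] at h1
      rw [dist_eq_norm] at hA
      have h2 : gB τ < m := (hgBmono hτ0 hτΔ).trans_lt hB
      have := (abs_lt.1 (h1.trans_lt (hA.trans_lt h2))).1
      linarith [huim τ ⟨hτ0, hτΔ⟩]
    have hsub : q τ - lam = lam * (g t - lswDriving t.toNNReal) := by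
      have h : q τ - lam = lam * (g (τ / lam ^ 2) - lswDriving (τ / lam ^ 2).toNNReal) :=
        scaled_sub_eq hlam0 hτ0
      rw [hτt] at h
      exact h
    have hnorm : ‖q τ - lam‖ < m := by
      rw [hsub, norm_mul, Complex.norm_real, Real.norm_eq_abs, abs_of_pos hlam0]
      calc lam * ‖g t - lswDriving t.toNNReal‖ < lam * (m / lam) :=
            mul_lt_mul_of_pos_left hlt hlam0
        _ = m := by field_simp
    have hge : m ≤ ‖q τ - lam‖ := by
      have := abs_im_le_norm (q τ - lam)
      rw [sub_im, ofReal_im, sub_zero] at this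
      exact hqim.le.trans ((le_abs_self _).trans this)
    linarith
  refine ⟨(mem_diff_smul_lswHull_iff hlam0 _).2 ⟨hw'H, claimB⟩, ?_⟩
  rw [smulHull_lswMap_eq_scaled hlam0 hg hΔ rfl claimB]
  exact claimA Δ hΔ le_rfl claimB Δ ⟨hΔ, le_rfl⟩

end Step

/-! ### The dilated flow near `0` and near `∞`: aliveness without a reference path -/

section Regimes

variable {lam : ℝ} {w : ℂ} {g : ℝ → ℂ}

/-- **A solution staying away from the driving function does not die** (extension criterion,
contrapositive of `IsSolution.exists_norm_sub_lt`): if the maximal solution from `w'` is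
`d`-far from `W` at all alive times `≤ b`, then it is alive at time `b`. [cite: Lawler2005, Ch. 4 §4.1] -/
theorem lt_swallowingTime_of_le_norm_sub {w' : ℂ} (hw' : w' ≠ lswDriving 0)
    (hg : IsSolution lswDriving w' g (swallowingTime lswDriving w')) {b : ℝ} (hb : 0 ≤ b)
    {d : ℝ} (hd : 0 < d)
    (hfar : ∀ t : ℝ, 0 ≤ t → t ≤ b → (t.toNNReal : WithTop ℝ≥0) < swallowingTime lswDriving w' →
      d ≤ ‖g t - lswDriving t.toNNReal‖) :
    ((b.toNNReal : ℝ≥0) : WithTop ℝ≥0) < swallowingTime lswDriving w' := by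
  by_contra hcon
  rw [not_lt] at hcon
  set T := swallowingTime lswDriving w' with hT
  have hTtop : T ≠ ⊤ := ne_top_of_le_ne_top WithTop.coe_ne_top hcon
  obtain ⟨b₀, hb₀⟩ := WithTop.ne_top_iff_exists.1 hTtop
  have hb₀le : (b₀ : ℝ) ≤ b := by
    have := WithTop.coe_le_coe.1 (hb₀.symm ▸ hcon : (b₀ : WithTop ℝ≥0) ≤ b.toNNReal)
    have h := NNReal.coe_le_coe.2 this
    rwa [Real.coe_toNNReal _ hb] at h
  have hb₀pos : 0 < b₀ := by
    have := swallowingTime_pos_holds continuous_lswDriving hw'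
    rw [← hT, ← hb₀] at this
    exact WithTop.coe_pos.1 this
  have hg' : IsSolution lswDriving w' g b₀ := by rw [hb₀]; exact hg
  obtain ⟨t, ht0, htb, hlt⟩ := hg'.exists_norm_sub_lt continuous_lswDriving hb₀pos hb₀.symm hd
  have htT : (t.toNNReal : WithTop ℝ≥0) < T := by
    rw [← hb₀]
    exact WithTop.coe_lt_coe.2 (by rw [← NNReal.coe_lt_coe, Real.coe_toNNReal _ ht0]; exact htb)
  have := hfar t ht0 (htb.le.trans hb₀le) htT
  linarith

/-- The frozen field is small near `0`: `|2q/((q - λ)λ)| ≤ (4/c²)|q|` for `|q| < c/2 ≤ λ/2`. [folklore] -/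
theorem norm_frozenField_le_of_norm_lt {q : ℂ} {c : ℝ} (hc : 0 < c) (hlam : c ≤ lam)
    (hq : ‖q‖ < c / 2) : ‖2 * q / ((q - lam) * lam)‖ ≤ 4 / c ^ 2 * ‖q‖ := by
  have hlam0 : 0 < lam := hc.trans_le hlam
  have hql : c / 2 ≤ ‖q - lam‖ := by
    have := norm_sub_norm_le (lam : ℂ) q
    rw [Complex.norm_real, Real.norm_eq_abs, abs_of_pos hlam0, norm_sub_rev] at this
    linarith
  rw [norm_div, norm_mul, norm_mul, Complex.norm_two, Complex.norm_real, Real.norm_eq_abs,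
    abs_of_pos hlam0, div_le_iff₀ (mul_pos ((half_pos hc).trans_le hql) hlam0)]
  have h1 : c / 2 * c ≤ ‖q - (lam : ℂ)‖ * lam := mul_le_mul hql hlam hc.le (norm_nonneg _)
  calc 2 * ‖q‖ = 4 / c ^ 2 * ‖q‖ * (c / 2 * c) := by field_simp; ring
    _ ≤ 4 / c ^ 2 * ‖q‖ * (‖q - (lam : ℂ)‖ * lam) := by gcongr

/-- The frozen field is bounded far out: `|2q/((q - λ)λ)| ≤ 4/c` for `|q| > 2λ`, `λ ≥ c`. [folklore] -/
theorem norm_frozenField_le_of_lt_norm {q : ℂ} {c : ℝ} (hc : 0 < c) (hlam : c ≤ lam)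
    (hq : 2 * lam < ‖q‖) : ‖2 * q / ((q - lam) * lam)‖ ≤ 4 / c := by
  have hlam0 : 0 < lam := hc.trans_le hlam
  have hql : ‖q‖ / 2 ≤ ‖q - lam‖ := by
    have := norm_sub_norm_le q (lam : ℂ)
    rw [Complex.norm_real, Real.norm_eq_abs, abs_of_pos hlam0] at this
    linarith
  have hq0 : 0 < ‖q‖ := by linarith
  rw [norm_div, norm_mul, norm_mul, Complex.norm_two, Complex.norm_real, Real.norm_eq_abs,
    abs_of_pos hlam0, div_le_iff₀ (mul_pos (by linarith) hlam0)]
  have h1 : ‖q‖ / 2 * c ≤ ‖q - (lam : ℂ)‖ * lam := mul_le_mul hql hlam hc.le (norm_nonneg _)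
  calc 2 * ‖q‖ = 4 / c * (‖q‖ / 2 * c) := by field_simp; ring
    _ ≤ 4 / c * (‖q - (lam : ℂ)‖ * lam) := by gcongr

/-- **The dilated flow from a point near `0` stays near `0` and is alive**: if `w ∈ ℍ` with
`|w| e^{4Δ/c²} ≤ c/4` and `λ ≥ c > 0`, then `w ∈ ℍ ∖ λK_{Δ/λ²}` and `|λG_{Δ/λ²}(w/λ)| ≤ |w| e^{4Δ/c²}`
(Grönwall for `|q|`, `|q'| ≤ (4/c²)|q|` while `|q| ≤ c/2`). This keeps the approximating hulls
away from `0`. [folklore] -/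
theorem small_step {c Δ : ℝ} (hΔ : 0 ≤ Δ) (hc : 0 < c) (hlam : c ≤ lam)
    (hw : w ∈ upperHalfPlaneSet) (hr : ‖w‖ * Real.exp (4 / c ^ 2 * Δ) ≤ c / 4) :
    w ∈ upperHalfPlaneSet \ lam • lswHull (Δ / lam ^ 2).toNNReal ∧
      ‖(lswMap (Δ / lam ^ 2).toNNReal).smulHull lam (hc.trans_le hlam) w‖ ≤
        ‖w‖ * Real.exp (4 / c ^ 2 * Δ) := by
  have hlam0 : 0 < lam := hc.trans_le hlam
  have hl2 : (0 : ℝ) < lam ^ 2 := by positivity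
  have hw'H : lam⁻¹ • w ∈ upperHalfPlaneSet := (inv_smul_mem_upperHalfPlaneSet_iff hlam0).2 hw
  have hw'1 : lam⁻¹ • w ≠ lswDriving 0 := fun h ↦ by
    have : (lam⁻¹ • w).im = 0 := by rw [h]; simp
    exact absurd this (ne_of_gt hw'H)
  obtain ⟨g, hg⟩ := exists_isSolution_swallowingTime_holds continuous_lswDriving hw'1
  set T := swallowingTime lswDriving (lam⁻¹ • w) with hT
  set q : ℝ → ℂ := fun τ ↦ (lam : ℂ) * (g (τ / lam ^ 2) + 2 * ((τ / lam ^ 2 : ℝ) : ℂ)) with hq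
  have hq0 : q 0 = w := scaled_apply_zero hlam0 hg
  set K : ℝ := 4 / c ^ 2 with hK
  have hK0 : 0 ≤ K := by positivity
  have hexp : ∀ {x y : ℝ}, x ≤ y → ‖w‖ * Real.exp (K * x) ≤ ‖w‖ * Real.exp (K * y) := fun hxy ↦
    mul_le_mul_of_nonneg_left (Real.exp_le_exp.2 (mul_le_mul_of_nonneg_left hxy hK0)) (norm_nonneg _)
  -- Grönwall for `|q|` on `[0, b]`, given `|q| < c/2` on `[0, b)`
  have gron : ∀ b : ℝ, 0 ≤ b → ((b / lam ^ 2).toNNReal : WithTop ℝ≥0) < T →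
      (∀ τ ∈ Ico 0 b, ‖q τ‖ < c / 2) → ∀ τ ∈ Icc 0 b, ‖q τ‖ ≤ ‖w‖ * Real.exp (K * τ) := by
    intro b hb0 hbT hsmall τ hτ
    have key := norm_le_gronwallBound_of_norm_deriv_right_le (f := q)
      (f' := fun τ ↦ 2 * q τ / ((q τ - lam) * lam)) (δ := ‖w‖) (K := K) (ε := 0) (a := 0) (b := b)
      (scaled_continuousOn hlam0 hg hbT) (fun t ht ↦ scaled_hasDerivWithinAt_Ici hlam0 hg hbT ht)
      (by rw [hq0]) (fun t ht ↦ by rw [add_zero]; exact norm_frozenField_le_of_norm_lt hc hlam (hsmall t ht))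
    have := key τ hτ
    rwa [gronwallBound_ε0, sub_zero] at this
  -- first exit: `|q| < c/2` on every alive `[0, b]`, `b ≤ Δ`
  have claimA : ∀ b : ℝ, 0 ≤ b → b ≤ Δ → ((b / lam ^ 2).toNNReal : WithTop ℝ≥0) < T →
      ∀ τ ∈ Icc 0 b, ‖q τ‖ ≤ ‖w‖ * Real.exp (K * τ) := by
    intro b hb0 hbΔ hbT
    refine gron b hb0 hbT fun s₁ hs₁ ↦ ?_
    by_contra hnot
    rw [not_lt] at hnot
    have hcont : ContinuousOn (fun τ ↦ ‖q τ‖) (Icc 0 b) :=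
      continuous_norm.comp_continuousOn (scaled_continuousOn hlam0 hg hbT)
    set S : Set ℝ := Icc 0 b ∩ (fun τ ↦ ‖q τ‖) ⁻¹' Ici (c / 2) with hS
    have hSc : IsClosed S := hcont.preimage_isClosed_of_isClosed isClosed_Icc isClosed_Ici
    have hs₁S : s₁ ∈ S := ⟨⟨hs₁.1, hs₁.2.le⟩, hnot⟩
    have hSbdd : BddBelow S := ⟨0, fun τ hτ ↦ hτ.1.1⟩
    set s₀ := sInf S with hs₀
    have hs₀S : s₀ ∈ S := hSc.csInf_mem ⟨s₁, hs₁S⟩ hSbdd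
    have hs₀0 : 0 ≤ s₀ := hs₀S.1.1
    have hs₀b : s₀ ≤ b := hs₀S.1.2
    have hbefore : ∀ τ ∈ Ico 0 s₀, ‖q τ‖ < c / 2 := fun τ hτ ↦ by
      by_contra hge
      rw [not_lt] at hge
      exact absurd (csInf_le hSbdd ⟨⟨hτ.1, hτ.2.le.trans hs₀b⟩, hge⟩) (not_le.2 hτ.2)
    have h1 := gron s₀ hs₀0 (toNNReal_div_sq_lt_of_le hlam0 hs₀b hbT) hbefore s₀ ⟨hs₀0, le_rfl⟩
    have h2 : ‖w‖ * Real.exp (K * s₀) ≤ c / 4 := (hexp (hs₀b.trans hbΔ)).trans hr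
    have h3 : c / 2 ≤ ‖q s₀‖ := hs₀S.2
    linarith
  -- aliveness
  have claimB : (((Δ / lam ^ 2).toNNReal : ℝ≥0) : WithTop ℝ≥0) < T := by
    refine lt_swallowingTime_of_le_norm_sub hw'1 hg (by positivity) (d := c / (2 * lam)) (by positivity)
      fun t ht0 htb htT ↦ ?_
    set τ : ℝ := lam ^ 2 * t with hτdef
    have hτt : τ / lam ^ 2 = t := by rw [hτdef]; field_simp
    have hτ0 : 0 ≤ τ := by positivity
    have hτΔ : τ ≤ Δ := by
      have : lam ^ 2 * t ≤ lam ^ 2 * (Δ / lam ^ 2) := mul_le_mul_of_nonneg_left htb hl2.le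
      rwa [mul_div_cancel₀ _ hl2.ne'] at this
    have hτT : ((τ / lam ^ 2).toNNReal : WithTop ℝ≥0) < T := by rw [hτt]; exact htT
    have hA := claimA τ hτ0 hτΔ hτT τ ⟨hτ0, le_rfl⟩
    have hqs : ‖q τ‖ < c / 2 := by
      have : ‖w‖ * Real.exp (K * τ) ≤ c / 4 := (hexp hτΔ).trans hr
      linarith
    have hsub : q τ - lam = lam * (g t - lswDriving t.toNNReal) := by
      have h : q τ - lam = lam * (g (τ / lam ^ 2) - lswDriving (τ / lam ^ 2).toNNReal) :=
        scaled_sub_eq hlam0 hτ0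
      rw [hτt] at h
      exact h
    have hql : c / 2 ≤ ‖q τ - lam‖ := by
      have := norm_sub_norm_le (lam : ℂ) (q τ)
      rw [Complex.norm_real, Real.norm_eq_abs, abs_of_pos hlam0, norm_sub_rev] at this
      linarith
    rw [hsub, norm_mul, Complex.norm_real, Real.norm_eq_abs, abs_of_pos hlam0] at hql
    rw [div_le_iff₀ (by positivity : (0 : ℝ) < 2 * lam)]
    nlinarith
  refine ⟨(mem_diff_smul_lswHull_iff hlam0 _).2 ⟨hw'H, claimB⟩, ?_⟩
  rw [smulHull_lswMap_eq_scaled hlam0 hg hΔ rfl claimB]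
  exact claimA Δ hΔ le_rfl claimB Δ ⟨hΔ, le_rfl⟩

/-- **The dilated flow from a far point stays far and is alive**: if `w ∈ ℍ` with
`|w| > 2C + 4Δ/c` and `c ≤ λ ≤ C`, then `w ∈ ℍ ∖ λK_{Δ/λ²}` and `|λG_{Δ/λ²}(w/λ)| ≥ |w| - 4Δ/c`
(`|q'| ≤ 4/c` while `|q| > 2λ`). This keeps the approximating hulls bounded. [folklore] -/
theorem large_step {c C Δ : ℝ} (hΔ : 0 ≤ Δ) (hc : 0 < c) (hlam : c ≤ lam) (hlamC : lam ≤ C)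
    (hw : w ∈ upperHalfPlaneSet) (hR : 2 * C + 4 / c * Δ < ‖w‖) :
    w ∈ upperHalfPlaneSet \ lam • lswHull (Δ / lam ^ 2).toNNReal ∧
      ‖w‖ - 4 / c * Δ ≤ ‖(lswMap (Δ / lam ^ 2).toNNReal).smulHull lam (hc.trans_le hlam) w‖ := by
  have hlam0 : 0 < lam := hc.trans_le hlam
  have hl2 : (0 : ℝ) < lam ^ 2 := by positivity
  have hw'H : lam⁻¹ • w ∈ upperHalfPlaneSet := (inv_smul_mem_upperHalfPlaneSet_iff hlam0).2 hw
  have hw'1 : lam⁻¹ • w ≠ lswDriving 0 := fun h ↦ by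
    have : (lam⁻¹ • w).im = 0 := by rw [h]; simp
    exact absurd this (ne_of_gt hw'H)
  obtain ⟨g, hg⟩ := exists_isSolution_swallowingTime_holds continuous_lswDriving hw'1
  set T := swallowingTime lswDriving (lam⁻¹ • w) with hT
  set q : ℝ → ℂ := fun τ ↦ (lam : ℂ) * (g (τ / lam ^ 2) + 2 * ((τ / lam ^ 2 : ℝ) : ℂ)) with hq
  have hq0 : q 0 = w := scaled_apply_zero hlam0 hg
  have h4c : 0 ≤ 4 / c := by positivity
  -- Grönwall (`K = 0`) for `q - w` on `[0, b]`, given `|q| > 2λ` on `[0, b)`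
  have gron : ∀ b : ℝ, 0 ≤ b → ((b / lam ^ 2).toNNReal : WithTop ℝ≥0) < T →
      (∀ τ ∈ Ico 0 b, 2 * lam < ‖q τ‖) → ∀ τ ∈ Icc 0 b, ‖q τ - w‖ ≤ 4 / c * τ := by
    intro b hb0 hbT hbig τ hτ
    have key := norm_le_gronwallBound_of_norm_deriv_right_le (f := fun τ ↦ q τ - w)
      (f' := fun τ ↦ 2 * q τ / ((q τ - lam) * lam)) (δ := 0) (K := 0) (ε := 4 / c) (a := 0) (b := b)
      ((scaled_continuousOn hlam0 hg hbT).sub continuousOn_const)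
      (fun t ht ↦ (scaled_hasDerivWithinAt_Ici hlam0 hg hbT ht).sub_const w)
      (by rw [hq0, sub_self, norm_zero])
      (fun t ht ↦ by rw [zero_mul, zero_add]; exact norm_frozenField_le_of_lt_norm hc hlam (hbig t ht))
    have := key τ hτ
    simp only [gronwallBound_K0, sub_zero, zero_add] at this
    exact this
  -- first exit: `|q| > 2λ` on every alive `[0, b]`, `b ≤ Δ`
  have claimA : ∀ b : ℝ, 0 ≤ b → b ≤ Δ → ((b / lam ^ 2).toNNReal : WithTop ℝ≥0) < T →
      ∀ τ ∈ Icc 0 b, ‖q τ - w‖ ≤ 4 / c * τ := by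
    intro b hb0 hbΔ hbT
    refine gron b hb0 hbT fun s₁ hs₁ ↦ ?_
    by_contra hnot
    rw [not_lt] at hnot
    have hcont : ContinuousOn (fun τ ↦ ‖q τ‖) (Icc 0 b) :=
      continuous_norm.comp_continuousOn (scaled_continuousOn hlam0 hg hbT)
    set S : Set ℝ := Icc 0 b ∩ (fun τ ↦ ‖q τ‖) ⁻¹' Iic (2 * lam) with hS
    have hSc : IsClosed S := hcont.preimage_isClosed_of_isClosed isClosed_Icc isClosed_Iic
    have hs₁S : s₁ ∈ S := ⟨⟨hs₁.1, hs₁.2.le⟩, hnot⟩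
    have hSbdd : BddBelow S := ⟨0, fun τ hτ ↦ hτ.1.1⟩
    set s₀ := sInf S with hs₀
    have hs₀S : s₀ ∈ S := hSc.csInf_mem ⟨s₁, hs₁S⟩ hSbdd
    have hs₀0 : 0 ≤ s₀ := hs₀S.1.1
    have hs₀b : s₀ ≤ b := hs₀S.1.2
    have hbefore : ∀ τ ∈ Ico 0 s₀, 2 * lam < ‖q τ‖ := fun τ hτ ↦ by
      by_contra hge
      rw [not_lt] at hge
      exact absurd (csInf_le hSbdd ⟨⟨hτ.1, hτ.2.le.trans hs₀b⟩, hge⟩) (not_le.2 hτ.2)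
    have h1 := gron s₀ hs₀0 (toNNReal_div_sq_lt_of_le hlam0 hs₀b hbT) hbefore s₀ ⟨hs₀0, le_rfl⟩
    have h2 : ‖w‖ - ‖q s₀ - w‖ ≤ ‖q s₀‖ := by
      have := norm_sub_le (q s₀) (q s₀ - w)
      rw [sub_sub_cancel] at this
      linarith
    have h3 : ‖q s₀‖ ≤ 2 * lam := hs₀S.2
    have h4 : 4 / c * s₀ ≤ 4 / c * Δ := mul_le_mul_of_nonneg_left (hs₀b.trans hbΔ) h4c
    linarith
  -- aliveness
  have claimB : (((Δ / lam ^ 2).toNNReal : ℝ≥0) : WithTop ℝ≥0) < T := by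
    refine lt_swallowingTime_of_le_norm_sub hw'1 hg (by positivity) (d := 1) one_pos
      fun t ht0 htb htT ↦ ?_
    set τ : ℝ := lam ^ 2 * t with hτdef
    have hτt : τ / lam ^ 2 = t := by rw [hτdef]; field_simp
    have hτ0 : 0 ≤ τ := by positivity
    have hτΔ : τ ≤ Δ := by
      have : lam ^ 2 * t ≤ lam ^ 2 * (Δ / lam ^ 2) := mul_le_mul_of_nonneg_left htb hl2.le
      rwa [mul_div_cancel₀ _ hl2.ne'] at this
    have hτT : ((τ / lam ^ 2).toNNReal : WithTop ℝ≥0) < T := by rw [hτt]; exact htT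
    have hA := claimA τ hτ0 hτΔ hτT τ ⟨hτ0, le_rfl⟩
    have hbig : 2 * lam < ‖q τ‖ := by
      have h2 : ‖w‖ - ‖q τ - w‖ ≤ ‖q τ‖ := by
        have := norm_sub_le (q τ) (q τ - w)
        rw [sub_sub_cancel] at this
        linarith
      have h4 : 4 / c * τ ≤ 4 / c * Δ := mul_le_mul_of_nonneg_left hτΔ h4c
      linarith
    have hsub : q τ - lam = lam * (g t - lswDriving t.toNNReal) := by
      have h : q τ - lam = lam * (g (τ / lam ^ 2) - lswDriving (τ / lam ^ 2).toNNReal) :=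
        scaled_sub_eq hlam0 hτ0
      rw [hτt] at h
      exact h
    have hql : lam ≤ ‖q τ - lam‖ := by
      have := norm_sub_norm_le (q τ) (lam : ℂ)
      rw [Complex.norm_real, Real.norm_eq_abs, abs_of_pos hlam0] at this
      linarith
    rw [hsub, norm_mul, Complex.norm_real, Real.norm_eq_abs, abs_of_pos hlam0] at hql
    by_contra hlt
    rw [not_le] at hlt
    have : lam * ‖g t - ↑(lswDriving t.toNNReal)‖ < lam * 1 := mul_lt_mul_of_pos_left hlt hlam0
    linarith
  refine ⟨(mem_diff_smul_lswHull_iff hlam0 _).2 ⟨hw'H, claimB⟩, ?_⟩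
  rw [smulHull_lswMap_eq_scaled hlam0 hg hΔ rfl claimB]
  have hA := claimA Δ hΔ le_rfl claimB Δ ⟨hΔ, le_rfl⟩
  show ‖w‖ - 4 / c * Δ ≤ ‖q Δ‖
  have := norm_sub_le (q Δ) (q Δ - w)
  rw [sub_sub_cancel] at this
  linarith

end Regimes

end Literature.Probability.RandomPlanarGeometry

end
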